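import Literature.AlgebraicGeometry.HodgeTheory.AbelianVarietyBettiFormsComparison
import Literature.AlgebraicGeometry.HodgeTheory.ComplexTorusIntegralCohomologyHodgeStructures
import Literature.Geometry.Kaehler.ComplexTorusLatticeGroupCohomologyAllDegrees
import Literature.Geometry.Kaehler.ComplexTorusNeronSeveriEndomorphisms

/-!
# The Néron–Severi form in the cup basis of a lattice frame: `E = ½ Σ_{a,b} E(λ_a, λ_b) ξ_a ⌣ ξ_b`

Layer `Literature/AlgebraicGeometry/HodgeTheory`; cell `hodgecm-mathlib`, rung B-I/(U), leaf (T3) file 2 (frame expansion) —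
companion of `ComplexTorusCartierDivisorChernCharacter` (`ch₁(𝒪_A(Θ)^an) = -(E₂⁻¹(E ⊗ 1)) ⊗ 1`).

For a complex torus `X = E/Φ(ℤ^ι)` on ANY finite index type and `E ∈ NS(X)` (`IsNSForm Φ η`) with integer Gram matrix
`G = intGram Φ η`, `G_ab = E(λ_a, λ_b)` ([Lange2023] §1.5.1), the invariant form `E ⊗ 1 ∈ Alt²_ℝ(E; ℂ)` expands in the
lattice monomials as the ORDER-FREE double sum `E ⊗ 1 = ½ Σ_a Σ_b G_ab dx_a ∧ dx_b`
(`ofRealForm_eq_sum_intGram_smul_latMonomial`; [Lange2023] Prop. 1.1.20 / Lemma 1.3.4: the classes `dx_a ∧ dx_b`,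
`a < b`, are a basis and `E = Σ_{a<b} E(λ_a, λ_b) dx_a ∧ dx_b`; the symmetric writing avoids a choice of order on `ι`).
Read for an abelian variety `A` analytified by `X` (`φ`, `hφ`) through the cup-algebraic Betti–forms comparison
`E₂ = bettiFormsEquivDeg Φ A φ hφ 2` of row A1-30, in ANY frame `γ : ι → H¹(A(ℂ); ℚ)` lifting the canonical classes
(`φ^* γ_a = ξ_a = latticeClass Φ a`): **`E₂⁻¹(E ⊗ 1) = ½ Σ_a Σ_b G_ab (γ_a ⌣ γ_b)`**
(`bettiFormsEquivDeg_symm_ofRealForm_eq_sum_cupPowOne`).  With file 1 this gives the coefficient matrix `-½ G`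
(`G = intGram`) of `ch₁(𝒪_A(Θ)^an)` in the frame `γ_a ⌣ γ_b` — the (T3) input of the flat-Gram engine.

Theorems only; no definition, no named fact.

## References

* [Lange2023AbelianVarietiesComplex] H. Lange, *Abelian Varieties over the Complex Numbers* (2023), §1.1.4 Prop. 1.1.20,
  §1.3.3 Lemma 1.3.4, §1.5.1, §2.1.2 Lemma 2.1.2.
* [HatcherAT2002] A. Hatcher, *Algebraic Topology* (2002), §3.2 Prop. 3.10 and Example 3.16.
-/

noncomputable section

open Literature.Geometry.Kaehler Literature.AlgebraicTopology.SingularHomology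
open Literature.NumberTheory.Transcendental
open Literature.AlgebraicGeometry.Motives (ComplexPoints AbelianVariety)

namespace Literature.AlgebraicGeometry.HodgeTheory

/-! ### §1 Torus level: `E ⊗ 1 = ½ Σ_a Σ_b G_ab dx_a ∧ dx_b` -/

section Torus

variable {ι : Type} [Fintype ι] [DecidableEq ι] {E : Type} [NormedAddCommGroup E] [NormedSpace ℂ E]
  (Φ : (ι → ℝ) ≃L[ℝ] E)

omit [Fintype ι] [DecidableEq ι] in
/-- The `2 × 2` minors of the coordinate frame on lattice vectors:
`(dx_a ∧ dx_b)(λ_{m₀}, λ_{m₁}) = m₀(a) m₁(b) - m₁(a) m₀(b)`. [cite: Lange2023AbelianVarietiesComplex, §1.1.4 Prop. 1.1.20] -/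
theorem latMonomial_two_apply_latticeTuple (a b : ι) (m : Fin 2 → ι → ℤ) :
    ComplexTorus.latMonomial Φ 2 ![a, b] (ComplexTorus.latticeTuple Φ m) =
      (m 0 a : ℂ) * (m 1 b : ℂ) - (m 1 a : ℂ) * (m 0 b : ℂ) := by
  rw [ComplexTorus.latMonomial_apply_eq_det_coord, Matrix.det_fin_two]
  simp only [Matrix.of_apply, Matrix.cons_val_zero, Matrix.cons_val_one, ComplexTorus.latticeTuple_apply,
    ComplexTorus.latticeVec, ComplexTorus.coord_apply, ContinuousLinearEquiv.symm_apply_apply]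
  push_cast
  ring

/-- **Bilinear expansion on lattice vectors**: `E(λ_{m₀}, λ_{m₁}) = Σ_a Σ_b m₀(a) G_ab m₁(b)` with the INTEGER Gram matrix
`G = intGram Φ η` of `E ∈ NS(X)` (`G_ab = E(λ_a, λ_b)`, `map_intGram`). [cite: Lange2023AbelianVarietiesComplex, §1.5.1] -/
theorem apply_latticeTuple_eq_sum_intGram {η : E [⋀^Fin 2]→L[ℝ] ℝ} (hη : ComplexTorus.IsNSForm Φ η)
    (m : Fin 2 → ι → ℤ) :
    ((η (ComplexTorus.latticeTuple Φ m) : ℝ) : ℂ) =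
      ∑ a, ∑ b, (m 0 a : ℂ) * ((ComplexTorus.intGram Φ η a b : ℤ) : ℂ) * (m 1 b : ℂ) := by
  have hGr : ∀ i j, LinearMap.BilinForm.toMatrix' (ComplexTorus.latticeBilin Φ η) i j =
      ((ComplexTorus.intGram Φ η i j : ℤ) : ℝ) := fun i j ↦ by
    change ComplexTorus.latticeGram Φ η i j = _
    rw [← congrFun (congrFun (ComplexTorus.map_intGram Φ hη) i) j, Matrix.map_apply]
  have h2 : η (ComplexTorus.latticeTuple Φ m) =
      ComplexTorus.latticeBilin Φ η (fun a ↦ (m 0 a : ℝ)) (fun a ↦ (m 1 a : ℝ)) := by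
    rw [ComplexTorus.latticeBilin_apply]
    congr 1
    funext i
    fin_cases i <;> rfl
  rw [h2, ← Matrix.toBilin'_toMatrix' (ComplexTorus.latticeBilin Φ η), Matrix.toBilin'_apply]
  simp only [hGr]
  push_cast
  rfl

/-- **`E ⊗ 1 = ½ Σ_a Σ_b E(λ_a, λ_b) dx_a ∧ dx_b`** for `E ∈ NS(X)` (order-free expansion in the lattice monomials on
ANY finite index type; both sides agree on every pair of lattice vectors, `G` being antisymmetric, and invariant
`2`-forms are determined by these values, Prop. 1.1.20). [cite: Lange2023AbelianVarietiesComplex, §1.1.4 Prop. 1.1.20 and §1.5.1] -/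
theorem ofRealForm_eq_sum_intGram_smul_latMonomial {η : E [⋀^Fin 2]→L[ℝ] ℝ} (hη : ComplexTorus.IsNSForm Φ η) :
    ComplexTorus.ofRealForm η =
      (2 : ℂ)⁻¹ • ∑ a, ∑ b, ((ComplexTorus.intGram Φ η a b : ℤ) : ℂ) • ComplexTorus.latMonomial Φ 2 ![a, b] := by
  -- antisymmetry of the integer Gram matrix
  have hanti : ∀ a b, ((ComplexTorus.intGram Φ η b a : ℤ) : ℂ) = -((ComplexTorus.intGram Φ η a b : ℤ) : ℂ) :=
    fun a b ↦ by
    have h : ((ComplexTorus.intGram Φ η b a : ℤ) : ℝ) = -((ComplexTorus.intGram Φ η a b : ℤ) : ℝ) := by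
      rw [← Matrix.map_apply (f := (Int.cast : ℤ → ℝ)) (M := ComplexTorus.intGram Φ η),
        ← Matrix.map_apply (f := (Int.cast : ℤ → ℝ)) (M := ComplexTorus.intGram Φ η), ComplexTorus.map_intGram Φ hη,
        ← Matrix.transpose_apply (ComplexTorus.latticeGram Φ η) a b, ComplexTorus.latticeGram_transpose,
        Matrix.neg_apply]
    exact_mod_cast h
  -- invariant forms are determined by their lattice periods (choose any order on `ι` for the monomial basis)
  letI : LinearOrder ι := LinearOrder.lift' (Fintype.equivFin ι) (Fintype.equivFin ι).injective
  refine ComplexTorus.form_eq_of_forall_latticeTuple Φ fun m ↦ ?_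
  rw [ComplexTorus.ofRealForm_apply, apply_latticeTuple_eq_sum_intGram Φ hη m]
  simp only [ContinuousAlternatingMap.smul_apply, ContinuousAlternatingMap.sum_apply,
    latMonomial_two_apply_latticeTuple, smul_eq_mul, mul_sub, Finset.sum_sub_distrib]
  have hswap : ∑ a, ∑ b, ((ComplexTorus.intGram Φ η a b : ℤ) : ℂ) * ((m 1 a : ℂ) * (m 0 b : ℂ)) =
      -∑ a, ∑ b, ((ComplexTorus.intGram Φ η a b : ℤ) : ℂ) * ((m 0 a : ℂ) * (m 1 b : ℂ)) := by
    rw [Finset.sum_comm, ← Finset.sum_neg_distrib]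
    refine Finset.sum_congr rfl fun a _ ↦ ?_
    rw [← Finset.sum_neg_distrib]
    refine Finset.sum_congr rfl fun b _ ↦ ?_
    rw [hanti a b]
    ring
  have hS : ∑ a, ∑ b, (m 0 a : ℂ) * ((ComplexTorus.intGram Φ η a b : ℤ) : ℂ) * (m 1 b : ℂ) =
      ∑ a, ∑ b, ((ComplexTorus.intGram Φ η a b : ℤ) : ℂ) * ((m 0 a : ℂ) * (m 1 b : ℂ)) :=
    Finset.sum_congr rfl fun a _ ↦ Finset.sum_congr rfl fun b _ ↦ by ring
  rw [hswap, hS]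
  ring

end Torus

/-! ### §2 Abelian variety: `E₂⁻¹(E ⊗ 1) = ½ Σ_a Σ_b G_ab (γ_a ⌣ γ_b)` in a lattice frame -/

section AbelianVariety

variable {ι : Type} [Fintype ι] [DecidableEq ι] {E : Type} [NormedAddCommGroup E] [NormedSpace ℂ E]
  [FiniteDimensional ℂ E] (Φ : (ι → ℝ) ≃L[ℝ] E) (A : AbelianVariety ℂ)
  (φ : C(ComplexTorus Φ, ComplexPoints A.X)) (hφ : IsAnalytification E A.X A.dim φ)

/-- In a frame `γ` lifting the canonical classes (`φ^* γ_a = ξ_a`), the Betti–forms equivalence reads `e(γ_a) = dx_a`.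
[cite: Lange2023AbelianVarietiesComplex, §1.1.3 Lemma 1.1.17 (a)] -/
theorem bettiFormsEquiv_eq_coordOneForm_of_map_eq_latticeClass
    (γ : ι → singularCohomology ℚ ℚ (ComplexPoints A.X) 1)
    (hγ : ∀ a, singularCohomology.map ℚ ℚ φ 1 (γ a) = latticeClass Φ a) (a : ι) :
    bettiFormsEquiv Φ φ hφ (γ a) = ComplexTorus.coordOneForm Φ a := by
  rw [bettiFormsEquiv_apply, hγ, latticeCoordHOne_latticeClass, coordForms, Fintype.linearCombination_apply_single,
    one_smul]

/-- `E₂(γ_a ⌣ γ_b) = dx_a ∧ dx_b` in such a frame. [cite: Lange2023AbelianVarietiesComplex, §1.1.4 Prop. 1.1.20] -/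
theorem bettiFormsEquivDeg_cupPowOne_two_eq_kMonomial
    (γ : ι → singularCohomology ℚ ℚ (ComplexPoints A.X) 1)
    (hγ : ∀ a, singularCohomology.map ℚ ℚ φ 1 (γ a) = latticeClass Φ a) (a b : ι) :
    bettiFormsEquivDeg Φ A φ hφ 2 (cupPowOne ℚ (ComplexPoints A.X) 2 ![γ a, γ b]) = kMonomial Φ 2 ![a, b] := by
  rw [bettiFormsEquivDeg_apply, bettiFormsMapDeg_cupPowOne]
  have h : (fun i : Fin 2 ↦ bettiFormsEquiv Φ φ hφ (![γ a, γ b] i)) = fun i ↦ ComplexTorus.coordOneForm Φ (![a, b] i) := by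
    funext i
    fin_cases i
    · exact bettiFormsEquiv_eq_coordOneForm_of_map_eq_latticeClass Φ A φ hφ γ hγ a
    · exact bettiFormsEquiv_eq_coordOneForm_of_map_eq_latticeClass Φ A φ hφ γ hγ b
  rw [h, exteriorPowerToForms_ιMulti_coordOneForm_eq_kMonomial]

omit [Fintype ι] [DecidableEq ι] [FiniteDimensional ℂ E] in
/-- `E ⊗ 1 ∈ H²(X, ℚ)_forms` for `E ∈ NS(X)`. [cite: Lange2023AbelianVarietiesComplex, §1.3.1 (1.10)] -/
theorem ofRealForm_mem_rationalForms_of_isNSForm {η : E [⋀^Fin 2]→L[ℝ] ℝ} (hη : ComplexTorus.IsNSForm Φ η) :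
    ComplexTorus.ofRealForm η ∈ ComplexTorus.rationalForms Φ 2 :=
  ComplexTorus.mem_rationalForms_of_mem_integralForms Φ (ComplexTorus.ofRealForm_mem_integralForms_two Φ hη)

/-- **(T3, frame form) `E₂⁻¹(E ⊗ 1) = ½ Σ_a Σ_b E(λ_a, λ_b) (γ_a ⌣ γ_b)` in `H²(A(ℂ); ℚ)`** for every abelian variety `A`
analytified by `X = E/Φ(ℤ^ι)`, every `E ∈ NS(X)` and every frame `γ : ι → H¹(A(ℂ); ℚ)` with `φ^* γ_a = ξ_a`
(`latticeClass`): the rational Betti class whose invariant form is `E ⊗ 1` has coefficient matrix `½ G`, `G = intGram Φ η`,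
on the products `γ_a ⌣ γ_b` (order-free double sum; `= Σ_{a<b} G_ab γ_a ⌣ γ_b`).  Companion of
`chernCharacter_cartierDivisorCocycle_hodgeModel_of_record` (`ch₁(𝒪_A(Θ)^an) = -(E₂⁻¹(E ⊗ 1)) ⊗ 1`).
[cite: Lange2023AbelianVarietiesComplex, §1.1.4 Prop. 1.1.20 and §2.1.2 Lemma 2.1.2] [cite: HatcherAT2002, §3.2 Example 3.16] -/
theorem bettiFormsEquivDeg_symm_ofRealForm_eq_sum_cupPowOne
    (γ : ι → singularCohomology ℚ ℚ (ComplexPoints A.X) 1)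
    (hγ : ∀ a, singularCohomology.map ℚ ℚ φ 1 (γ a) = latticeClass Φ a)
    {η : E [⋀^Fin 2]→L[ℝ] ℝ} (hη : ComplexTorus.IsNSForm Φ η) :
    (bettiFormsEquivDeg Φ A φ hφ 2).symm ⟨ComplexTorus.ofRealForm η, ofRealForm_mem_rationalForms_of_isNSForm Φ hη⟩ =
      (1 / 2 : ℚ) • ∑ a, ∑ b, ((ComplexTorus.intGram Φ η a b : ℤ) : ℚ) •
        cupPowOne ℚ (ComplexPoints A.X) 2 ![γ a, γ b] := by
  apply (bettiFormsEquivDeg Φ A φ hφ 2).injective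
  rw [LinearEquiv.apply_symm_apply]
  apply Subtype.ext
  simp only [map_smul, map_sum, bettiFormsEquivDeg_cupPowOne_two_eq_kMonomial Φ A φ hφ γ hγ, Submodule.coe_smul,
    Submodule.coe_sum, coe_kMonomial]
  rw [ofRealForm_eq_sum_intGram_smul_latMonomial Φ hη]
  simp only [← Rat.cast_smul_eq_qsmul ℂ, Rat.cast_intCast, one_div, Rat.cast_inv, Rat.cast_ofNat]

end AbelianVariety

end Literature.AlgebraicGeometry.HodgeTheory

end
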